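import Mathlib
import Summits.NavierStokesRegularity.NavierStokesRegularity.Theorems.ThreadingFluxHorizonTowerFiniteTowerEvenPair
import HarnessLib

/-!
# Crux `PoloidalLiouville` (stmt-NavierStokesRegularity-1222), crux idea «horizon-threading-tower» (ns-idea-15):
# THE UNIAXIAL EXIT — a shell generated by a quadratic with a repeated eigenvalue is zonal about a real axis

Support file (`--supports stmt-NavierStokesRegularity-1222`, helper; cell `ns-wall-extremal`, width hand ns-wall-eng-3 g6; 0 kit).

★ `exists_axis_of_genW_eq_zero`: the common last step of THM F/G/H/I/J, exported once.  For a real quadratic generator `L = xᵀQx ≠ 0`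
with `W = det(x,Qx,Q²x) ≡ 0` and a real solid harmonic `P` of degree `D = 2k ≥ 1` whose null-cone chart is `g · (chartT L)^k`, there is a
real axis `v ≠ 0` with `{⟪v,x⟫, P} = 0`:  `W = 0` gives `{L, M₀} = 0` for the harmonic part `M₀` of `M = |Qx|²`, same-degree bracket
rigidity (`LoopLaw.sameDegreeBracketRigidity`, p684047) makes `M₀ = βL`, i.e. `Q² = βQ + γI`, the uniaxial lemma
(`Zonal.exists_axis_of_genM_eq`, p709873) makes `L` zonal about a real axis `v`, so `chartT L = β′(chartT⟪v,x⟫)²`, `chartT P = gβ′^k (chartT⟪v,x⟫)^D`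
and `P` is zonal about `v` (`Zonal.detP_lin_eq_zero_of_chartT_eq`).  (Steps (6)–(7) of `finiteTower_exists_axis_of_evenPair`, verbatim.)

HONEST LABEL: polynomial-algebra tool; no tower theorem in this file; `PoloidalLiouville` (1222) OPEN; W1 movement 0; NS regularity NOT
proved.  [folklore]
-/

-- the summit and its single sub-problem share the name (CONVENTIONS §1)
set_option linter.dupNamespace false
-- `simp only` closers over `C`-coefficients are import-order sensitive (simprocs); keep the lists explicit, silence the arg linter
set_option linter.unusedSimpArgs false

noncomputable section

open MvPolynomial Complex
open scoped Polynomial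

namespace Summit.NavierStokesRegularity.NavierStokesRegularity.Theorems.PoloidalLiouville.HorizonTower

/-- ★ **THE UNIAXIAL EXIT.**  `L ≠ 0` a real quadratic generator with `W = det(x,Qx,Q²x) = 0`, `P` a real solid harmonic of degree
`D = 2k ≥ 1` with `chartT P = g·(chartT L)^k`: then `P` is annihilated by the rotation derivative about a real axis `v ≠ 0`. [folklore] -/
theorem exists_axis_of_genW_eq_zero (ra rb rd re rf : ℝ) (hL0 : Zonal.genL ra rb rd re rf ≠ 0) (hW0 : Zonal.genW ra rb rd re rf = 0)
    {P : Zonal.RPoly} {D k : ℕ} (hPh : P.IsHomogeneous D) (hPl : Zonal.lapP P = 0) (hD1 : 1 ≤ D) (hDk : D = 2 * k) (g : ℝ)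
    (hchart : Zonal.chartT (map (algebraMap ℝ ℂ) P)
      = Polynomial.C ((g : ℝ) : ℂ) * Zonal.chartT (map (algebraMap ℝ ℂ) (Zonal.genL ra rb rd re rf)) ^ k) :
    ∃ v : Fin 3 → ℝ, v ≠ 0 ∧ Zonal.detP (C (v 0) * X 0 + C (v 1) * X 1 + C (v 2) * X 2) P = 0 := by
  set L := Zonal.genL ra rb rd re rf with hLdef
  -- `{L, M₀} = 0`, same-degree rigidity, the uniaxial lemma
  set M₀ : Zonal.RPoly := Zonal.genM ra rb rd re rf - C (Zonal.genTau ra rb rd re rf / 3) * Zonal.normSq with hM₀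
  have hM₀h : M₀.IsHomogeneous 2 := (Zonal.isHomogeneous_genM ra rb rd re rf).sub (Zonal.isHomogeneous_normSq.C_mul _)
  have hM₀l : Zonal.lapP M₀ = 0 := by
    rw [hM₀, Zonal.lapP_sub, Zonal.lapP_C_mul, Zonal.lapP_genM, Zonal.lapP_normSq, ← map_mul, ← map_sub,
      show 2 * Zonal.genTau ra rb rd re rf - Zonal.genTau ra rb rd re rf / 3 * 6 = 0 by ring, map_zero]
  have hbr : Zonal.detP L M₀ = 0 := by
    rw [hM₀, Zonal.detP_sub_right, Zonal.detP_C_mul_right, Zonal.detP_normSq_right, mul_zero, sub_zero, hLdef,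
      Zonal.detP_genL_genM, hW0, mul_zero]
  obtain ⟨β, hβ⟩ := LoopLaw.sameDegreeBracketRigidity 2 L M₀ (by norm_num)
    ⟨Zonal.isHomogeneous_genL ra rb rd re rf, Zonal.laplacian_eval_eq_zero_of_lapP (Zonal.lapP_genL ra rb rd re rf)⟩
    ⟨hM₀h, Zonal.laplacian_eval_eq_zero_of_lapP hM₀l⟩ hL0 (Zonal.bracket_eval_eq_zero_of_detP hbr)
  have hM : Zonal.genM ra rb rd re rf = C β * Zonal.genL ra rb rd re rf + C (Zonal.genTau ra rb rd re rf / 3) * Zonal.normSq := by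
    rw [← hLdef, ← smul_eq_C_mul, ← hβ, hM₀]; ring
  obtain ⟨v, hv, hrot⟩ := Zonal.exists_axis_of_genM_eq ra rb rd re rf hM
  refine ⟨v, hv, ?_⟩
  -- zonality of the shell from the zonality of the generator
  set a : Fin 3 → ℂ := fun i => ((v i : ℝ) : ℂ) with ha'
  have ha : a ≠ 0 := ofReal_axis_ne_zero hv
  have hlin : map (algebraMap ℝ ℂ) (C (v 0) * X 0 + C (v 1) * X 1 + C (v 2) * X 2 : MvPolynomial (Fin 3) ℝ)
      = C (a 0) * X 0 + C (a 1) * X 1 + C (a 2) * X 2 := map_lin v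
  have hrotL : Zonal.detP (C (a 0) * X 0 + C (a 1) * X 1 + C (a 2) * X 2) (map (algebraMap ℝ ℂ) L) = 0 := by
    rw [← hlin, ← Zonal.map_detP, hrot, map_zero]
  obtain ⟨β', hβ'⟩ := Zonal.exists_chartT_eq_C_mul_pow_of_detP_lin_eq_zero ((Zonal.isHomogeneous_genL ra rb rd re rf).map _)
    (by norm_num) ha hrotL
  have hchartD : Zonal.chartT (map (algebraMap ℝ ℂ) P)
      = Polynomial.C (((g : ℝ) : ℂ) * β' ^ k) * Zonal.chartT (C (a 0) * X 0 + C (a 1) * X 1 + C (a 2) * X 2) ^ D := by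
    rw [hchart, hLdef, hβ', mul_pow, ← Polynomial.C_pow, ← mul_assoc, ← Polynomial.C_mul, ← pow_mul, hDk]
  have hzon := Zonal.detP_lin_eq_zero_of_chartT_eq (hPh.map (algebraMap ℝ ℂ)) hD1 (by rw [← Zonal.map_lapP, hPl, map_zero]) a hchartD
  rw [← hlin, ← Zonal.map_detP, map_eq_zero_iff _ (map_injective (algebraMap ℝ ℂ) (RCLike.ofReal_injective))] at hzon
  exact hzon

end Summit.NavierStokesRegularity.NavierStokesRegularity.Theorems.PoloidalLiouville.HorizonTower

end
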